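import Summits.QuantumFields.YangMills.Theorems.LangevinControlUVOSLegsFromFemtoAndGapStubAssemblyPlaneExpansion
import Summits.QuantumFields.YangMills.Theorems.LangevinControlUVOSLegsFromFemtoAndGapStubAssemblyStrings
import Summits.QuantumFields.YangMills.Theorems.LangevinControlUVOSLegsFromFemtoAndGapStubAssemblyShiftedBound
import HarnessLib

/-!
# Soft OS-assembly toolkit XIV: plane-string weights — identification, bounds, a-uniform (shifted) bound

Helper file for stub `stub_assembly6` of crux `OSLegsFromFemtoAndGap` (stmt-QuantumFields-9367, line
`dlr-collar-transfer`, reshape r2).  The reflection-positivity blocks work with the lattice distributions of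
STRINGS of single-plane plaquette fields.  Here:
* `originPlane r q := plaquetteObs r.ρ 0 q.1 q.2` and `plane G r q x = originPlane r q ∘ τ₋ₓ` (`rfl`);
* the plane means do not depend on the site (`torusE_plane_eq_wilsonTorusMean`) and the centred mixed moment
  bounded by `MomentBounds6` IS the string weight `torusMomentStr` of toolkit VIII-a with the canonical centring
  (`torusE_prod_plane_eq_torusMomentStr`);
* sup bound `(2Cₚ)ⁿ` (`abs_torusMomentStr_plane_le`) and, from `MomentBounds6`, the collar bound;
* **`norm_latticeSumStr_plane_le`**: the a-uniform bound of toolkit X-b for plane strings at shifted evaluation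
  points — `‖Σₓ W^{q}(x) F(y(x))‖ ≤ Kⁿ (S₀,₄ₙ + S₆ₙ,₄ₙ + S₀,₀ + S₆ₙ,₀ + S₁₀ₙ,₀)(F)`, ONE `K` for all strings,
  all shifts `‖y(x)_l − a x_l‖ ≤ 6 a` (so `a ≤ 1/24`), all `n ≥ 2`.
-/

noncomputable section

open scoped SchwartzMap BigOperators
open MeasureTheory Filter Topology
open Literature.MathematicalPhysics.QuantumFieldTheory Literature.MathematicalPhysics.QuantumLattice
open Literature.MathematicalPhysics.AQFT
open Literature.Probability.LatticeModels (box Site)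
open Summit.QuantumFields.YangMills.Cruxes.OSLegsFromFemtoAndGap.DlrCollarTransfer
  (torusE plane MomentBounds6 exists_abs_plane_le)

namespace Summit.QuantumFields.YangMills.Theorems.OSLegsFromFemtoAndGap

local notation "E4" => EuclideanSpace ℝ (Fin 4)

variable {G : Type} [Group G] [TopologicalSpace G] [IsTopologicalGroup G] [CompactSpace G]
  [MeasurableSpace G] [BorelSpace G]

/-! ### The plane fields as translates of origin observables -/

omit [IsTopologicalGroup G] [CompactSpace G] [BorelSpace G] in
/-- `plane G r q x` is the origin plaquette observable `plaquetteObs r.ρ 0 q.1 q.2` translated to `x`. -/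
theorem plane_eq_comp_configShift (r : LatticeRep G) (q : Fin 4 × Fin 4) (x : Site 4) :
    plane G r q x = (fun U => plaquetteObs r.ρ 0 q.1 q.2 U) ∘ configShift (-x) :=
  rfl

/-- **The torus mean of a translated observable is its `wilsonTorusMean`.** -/
theorem torusE_comp_configShift (r : LatticeRep G) (β : ℝ) (L : ℕ) (O : LGConfig 4 G → ℝ) (x : Site 4) :
    torusE G r β L (O ∘ configShift (-x)) = wilsonTorusMean r.ρ β L O := by
  rw [torusE_eq_wilsonExpectation, toTorusObservable_comp_configShift, wilsonExpectation_comp_torusConfigShift]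
  simp [wilsonExpectation, wilsonTorusMean, toTorusObservable]

/-- The plane means do not depend on the site. -/
theorem torusE_plane_eq_wilsonTorusMean (r : LatticeRep G) (β : ℝ) (L : ℕ) (q : Fin 4 × Fin 4) (x : Site 4) :
    torusE G r β L (plane G r q x) = wilsonTorusMean r.ρ β L (fun U => plaquetteObs r.ρ 0 q.1 q.2 U) := by
  rw [plane_eq_comp_configShift, torusE_comp_configShift]

/-- **The centred mixed plane moment of `MomentBounds6` is the string weight `torusMomentStr`.** -/
theorem torusE_prod_plane_eq_torusMomentStr (r : LatticeRep G) (β : ℝ) (L : ℕ) {n : ℕ}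
    (q : Fin n → Fin 4 × Fin 4) (x : Fin n → Site 4) :
    torusE G r β L (fun U => ∏ i, (plane G r (q i) (x i) U - torusE G r β L (plane G r (q i) (x i)))) =
      torusMomentStr r.ρ β L (fun i U => plaquetteObs r.ρ 0 (q i).1 (q i).2 U)
        (fun i => wilsonTorusMean r.ρ β L (fun U => plaquetteObs r.ρ 0 (q i).1 (q i).2 U)) x := by
  simp only [torusE_plane_eq_wilsonTorusMean]
  rfl

/-! ### Sup and collar bounds for the plane-string weights -/

/-- **Sup bound** `|W^{q}(x)| ≤ (Cₚ + Cₚ)ⁿ` for the plane-string weights. -/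
theorem abs_torusMomentStr_plane_le (r : LatticeRep G) {Cp : ℝ}
    (hCp : ∀ (q : Fin 4 × Fin 4) (x : Fin 4 → ℤ) (U : LGConfig 4 G), |plane G r q x U| ≤ Cp)
    (β : ℝ) (L : ℕ) {n : ℕ} (q : Fin n → Fin 4 × Fin 4) (x : Fin n → Site 4) :
    |torusMomentStr r.ρ β L (fun i U => plaquetteObs r.ρ 0 (q i).1 (q i).2 U)
        (fun i => wilsonTorusMean r.ρ β L (fun U => plaquetteObs r.ρ 0 (q i).1 (q i).2 U)) x| ≤ (Cp + Cp) ^ n := by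
  haveI := isProbabilityMeasure_wilsonMeasure (d := 4) (L := 2 * L + 1) r.ρ r.continuous β
  have hCp0 : 0 ≤ Cp := le_trans (abs_nonneg _) (hCp (0, 1) 0 (fun _ => 1))
  -- the means are bounded by `Cp`
  have hmean : ∀ i, |wilsonTorusMean r.ρ β L (fun U => plaquetteObs r.ρ 0 (q i).1 (q i).2 U)| ≤ Cp := by
    intro i
    rw [← torusE_plane_eq_wilsonTorusMean r β L (q i) 0]
    unfold torusE
    have h := norm_integral_le_of_norm_le_const (μ := wilsonMeasure (d := 4) (L := 2 * L + 1) r.ρ β)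
      (f := fun U => plane G r (q i) 0 (torusLift (2 * L + 1) U)) (C := Cp)
      (Eventually.of_forall fun U => by rw [Real.norm_eq_abs]; exact hCp _ _ _)
    simpa [Real.norm_eq_abs] using h
  unfold torusMomentStr
  have hbound : ∀ U : GaugeConfig 4 (2 * L + 1) G,
      ‖∏ i, (plaquetteObs r.ρ 0 (q i).1 (q i).2 (configShift (-(x i)) (torusLift (2 * L + 1) U)) -
        wilsonTorusMean r.ρ β L (fun U => plaquetteObs r.ρ 0 (q i).1 (q i).2 U))‖ ≤ (Cp + Cp) ^ n := fun U => by
    rw [Real.norm_eq_abs, Finset.abs_prod]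
    calc _ ≤ ∏ _i : Fin n, (Cp + Cp) := Finset.prod_le_prod (fun _ _ => abs_nonneg _) fun i _ =>
          (abs_sub _ _).trans (add_le_add (hCp (q i) (x i) _) (hmean i))
      _ = (Cp + Cp) ^ n := by simp
  have h := norm_integral_le_of_norm_le_const (μ := wilsonMeasure (d := 4) (L := 2 * L + 1) r.ρ β)
    (Eventually.of_forall hbound)
  simpa [Real.norm_eq_abs] using h

/-- **Collar bound from `MomentBounds6`** in the currency of `torusMomentStr`. -/
theorem abs_torusMomentStr_plane_le_of_momentBounds6 (r : LatticeRep G) {a : ℝ → ℝ} (h : MomentBounds6 G r a) :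
    ∃ (C β₄ ℓ₄ : ℝ), 0 < ℓ₄ ∧ 0 ≤ C ∧ ∀ β : ℝ, β₄ ≤ β → ∀ (L n : ℕ) (q : Fin n → Fin 4 × Fin 4)
      (x : Fin n → Site 4) (R : ℕ), (∀ i, (q i).1 < (q i).2) → 1 ≤ R → (R : ℝ) * a β ≤ ℓ₄ → 4 * R + 8 ≤ L →
      (∀ i j : Fin n, i ≠ j → ∃ k : Fin 4,
        (2 * (R : ℤ) + 4) ≤ |((((x i k - x j k : ℤ) : ZMod (2 * L + 1))).valMinAbs : ℤ)|) →
      |torusMomentStr r.ρ β L (fun i U => plaquetteObs r.ρ 0 (q i).1 (q i).2 U)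
        (fun i => wilsonTorusMean r.ρ β L (fun U => plaquetteObs r.ρ 0 (q i).1 (q i).2 U)) x| ≤
        (C / (R : ℝ) ^ 4) ^ n := by
  obtain ⟨C, β₄, ℓ₄, hℓ, hC, H⟩ := h
  refine ⟨C, β₄, ℓ₄, hℓ, hC, fun β hβ L n q x R hq hR hRa hRL hsep => ?_⟩
  rw [← torusE_prod_plane_eq_torusMomentStr]
  exact H β hβ L n q x R hq hR hRa hRL hsep

/-! ### The a-uniform bound for plane strings at shifted points -/

/-- **A-uniform bound for plane strings, shifted evaluation points.**  From `MomentBounds6`: one constant `K`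
such that for every valid plane string `q`, every `β ≥ β₄`, `0 < a β ≤ min (1/24) ℓ₄`, `L ≥ 14`, `L ≥ a⁻²`,
`n ≥ 2`, `F ∈ ⁰𝒮ₙ`, and evaluation points `y(x)` within six lattice units, `‖y(x)_l − a x_l‖ ≤ 6 a`:
`‖Σₓ W^{q}(x) F(y(x))‖ ≤ Kⁿ · (S₀,₄ₙ + S₆ₙ,₄ₙ + S₀,₀ + S₆ₙ,₀ + S₁₀ₙ,₀)(F)`. -/
theorem norm_latticeSumStr_plane_le (r : LatticeRep G) {a : ℝ → ℝ} (hMB : MomentBounds6 G r a) :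
    ∃ (β₄ ℓ₄ K : ℝ), 0 < ℓ₄ ∧ 0 ≤ K ∧ ∀ β : ℝ, β₄ ≤ β → 0 < a β → a β ≤ 1 / 24 → a β ≤ ℓ₄ →
      ∀ L : ℕ, 14 ≤ L → (a β)⁻¹ * (a β)⁻¹ ≤ L →
      ∀ n : ℕ, 2 ≤ n → ∀ q : Fin n → Fin 4 × Fin 4, (∀ i, (q i).1 < (q i).2) →
      ∀ F : 𝓢((Fin n → E4), ℂ), IsOffDiagonal F →
      ∀ y : (Fin n → Site 4) → (Fin n → E4), (∀ x l, ‖y x l - a β • siteToE (x l)‖ ≤ 6 * a β) →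
        ‖∑ x ∈ Fintype.piFinset (fun _ : Fin n => box 4 L),
            ((torusMomentStr r.ρ β L (fun i U => plaquetteObs r.ρ 0 (q i).1 (q i).2 U)
              (fun i => wilsonTorusMean r.ρ β L (fun U => plaquetteObs r.ρ 0 (q i).1 (q i).2 U)) x : ℝ) : ℂ) *
            F (y x)‖ ≤
          K ^ n * (SchwartzMap.seminorm ℂ 0 (4 * n) F + SchwartzMap.seminorm ℂ (6 * n) (4 * n) F +
            SchwartzMap.seminorm ℂ 0 0 F + SchwartzMap.seminorm ℂ (6 * n) 0 F +
            SchwartzMap.seminorm ℂ (10 * n) 0 F) := by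
  obtain ⟨C, β₄, ℓ₄, hℓ, hC, H⟩ := abs_torusMomentStr_plane_le_of_momentBounds6 r hMB
  obtain ⟨Cp, hCp⟩ := exists_abs_plane_le (G := G) r
  have hCp0 : 0 ≤ Cp := le_trans (abs_nonneg _) (hCp (0, 1) 0 (fun _ => 1))
  set M : ℝ := Cp + Cp with hM
  have hM0 : 0 ≤ M := by positivity
  refine ⟨β₄, ℓ₄, (M * 4 ^ 4 * 5 ^ 6 + M * 2 ^ 6 * (10 + 2 * 6) ^ 4 + 16 * C * 2 ^ 6 * (2 / ℓ₄ + 48) ^ 4) * 2 ^ 6 *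
      (81 * ∑' m : ℕ, (((m : ℝ) + 1) ^ 2)⁻¹), hℓ, ?_, ?_⟩
  · have : 0 ≤ ∑' m : ℕ, (((m : ℝ) + 1) ^ 2)⁻¹ := tsum_nonneg fun m => by positivity
    positivity
  intro β hβ ha ha24 haℓ L hL14 hLa n hn q hq F hF y hyx
  have ha1 : a β ≤ 1 := ha24.trans (by norm_num)
  have hsa : 6 * a β ≤ 1 / 4 := by linarith
  exact norm_sum_weight_mul_le hℓ hC hM0 _ (fun x => abs_torusMomentStr_plane_le r hCp β L q x)
    (fun x R hR hRa hRL hsep => H β hβ L n q x R hq hR hRa hRL hsep) ha ha1 haℓ hL14 hLa hn (by norm_num)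
    le_rfl hsa F hF y hyx

end Summit.QuantumFields.YangMills.Theorems.OSLegsFromFemtoAndGap

end
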